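import Literature.Barriers.MatrixMultiplication.IrreversibilityBarrier
import HarnessLib

/-!
# Route `SaturationLadder` — the change of basis from the split to the diagonal big Coppersmith–Winograd tensor:
# contraction lemmas and the Gram identity
# (decomp-mm lens 1, gen 41; part 2 of 3 of the curvilinear-domination kernel — part 1
# `SaturationLadderCurvilinearDomination` (`P_{q+2} ⊵ L_q`), part 3 `SaturationLadderCurvilinearDominationCw`
# (`L_q ≅ CW_q` over `ℂ`, hence `P_{q+2} ⊵ CW_q`); support beneath crux `SubexpSaturation`, stmt-MatrixMultiplication-25909)

PROVED, 0 sorry; no definitions, no instances, no named facts; elementary linear algebra over a field `K`.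

CONTENT.  `L_q z x y = [x + y = z ∧ (x = 0 ∨ y = 0 ∨ z = q+1)]` on `Fin (q+2)` (part 1) splits pointwise
(`splitCw_apply_eq_sum`) into the left-unit family `(a; 0, a)`, the right-unit family `(a; a, 0)` (`a ≠ 0`) and the
antidiagonal pairing `(q+1; b, q+1−b)` (`1 ≤ b ≤ q`, i.e. `c = Fin.rev b`); `sum_unitLeft`, `sum_unitRight`,
`sum_pairing` contract a triple of matrices `A, B, C` (BCS (14.4): `(A ⊗ B ⊗ C)·t (a',b',c') =
Σ_{a,b,c} A a' a · B b' b · C c' c · t a b c`, the tree's `TensorRestrictsTo`) against each family.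
`pairing_gram` is the heart: for `i, h ∈ K` with `i² = −1`, `h + h = 1` the matrix `U` with rows supported on the
pairs `{p, q+1−p}` — `U p p = 1`, `U p (q+1−p) = i` if `p < q+1−p`; `U p p = −i h`, `U p (q+1−p) = h` if
`p > q+1−p`; `U p p = 1` at a fixed point `p = q+1−p` — satisfies
`Σ_{1 ≤ a ≤ q} U (q+1−a) j · U a k = [j = k ∧ 1 ≤ j ≤ q]`, i.e. `Uᵀ S U = 1` for the split form `S`: it carries
`Σ_a x_a x_{q+1−a}` to `Σ_j y_j²` (`2 × 2` blocks: `h·1 + 1·h = 1`, `i·(−i h) + (−i h)·i = 2h = 1`, cross terms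
`(−i h)·1 + i·h = 0`).  Part 3 feeds `U` into the contraction lemmas.
[cite: BurgisserClausenShokrollahi1997, (14.4), Ex. (15.20); ChristandlVranaZuiddam2021, Thm. 22]
-/

set_option linter.dupNamespace false

noncomputable section

open scoped BigOperators

namespace Summit.MatrixMultiplication.MatrixMultiplication.Theorems.SaturationLadderSplitCwGram

universe u

variable {K : Type u} [Field K]

/-- Pointwise splitting of the split tensor `L_q` into its three support families: the left unit
`(a; 0, a)`, the right unit `(a; a, 0)` (`a ≠ 0`), and the antidiagonal pairing `(q+1; b, q+1−b)`
(`1 ≤ b ≤ q`). [cite: BurgisserClausenShokrollahi1997, Ex. (15.20)] -/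
theorem splitCw_apply_eq_sum (q : ℕ) (a b c : Fin (q + 2)) :
    (if (b : ℕ) + (c : ℕ) = (a : ℕ) ∧ ((b : ℕ) = 0 ∨ (c : ℕ) = 0 ∨ (a : ℕ) = q + 1) then (1 : K) else 0) =
      (if b = 0 ∧ c = a then (1 : K) else 0) + (if c = 0 ∧ b = a ∧ a ≠ 0 then (1 : K) else 0) +
        (if a = Fin.last (q + 1) ∧ b ≠ 0 ∧ b ≠ Fin.last (q + 1) ∧ c = Fin.rev b then (1 : K) else 0) := by
  have ha := a.isLt
  have hb := b.isLt
  have hc := c.isLt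
  split_ifs <;>
    (try simp only [Fin.ext_iff, Fin.val_zero, Fin.val_last, Fin.val_rev, ne_eq] at *) <;>
    first | (exfalso; omega) | norm_num

variable {q : ℕ}

/-- Contraction against the left-unit family. [cite: BurgisserClausenShokrollahi1997, (14.4) (restriction by matrices)] -/
theorem sum_unitLeft (A B C : Fin (q + 2) → Fin (q + 2) → K) (a' b' c' : Fin (q + 2)) :
    ∑ a, ∑ b, ∑ c, A a' a * B b' b * C c' c * (if b = 0 ∧ c = a then (1 : K) else 0) =
      ∑ a, A a' a * B b' 0 * C c' a := by
  refine Finset.sum_congr rfl fun a _ => ?_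
  rw [Finset.sum_eq_single (0 : Fin (q + 2))]
  · rw [Finset.sum_eq_single a]
    · simp
    · intro c _ hc
      simp [hc]
    · simp
  · intro b _ hb
    exact Finset.sum_eq_zero fun c _ => by simp [hb]
  · simp

/-- Contraction against the right-unit family. [cite: BurgisserClausenShokrollahi1997, (14.4)] -/
theorem sum_unitRight (A B C : Fin (q + 2) → Fin (q + 2) → K) (a' b' c' : Fin (q + 2)) :
    ∑ a, ∑ b, ∑ c, A a' a * B b' b * C c' c * (if c = 0 ∧ b = a ∧ a ≠ 0 then (1 : K) else 0) =
      ∑ a, if a = 0 then (0 : K) else A a' a * B b' a * C c' 0 := by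
  refine Finset.sum_congr rfl fun a _ => ?_
  rw [Finset.sum_eq_single a]
  · rw [Finset.sum_eq_single (0 : Fin (q + 2))]
    · by_cases ha : a = 0 <;> simp [ha]
    · intro c _ hc
      simp [hc]
    · simp
  · intro b _ hb
    exact Finset.sum_eq_zero fun c _ => by simp [hb]
  · simp

/-- Contraction against the antidiagonal pairing family. [cite: BurgisserClausenShokrollahi1997, (14.4)] -/
theorem sum_pairing (A B C : Fin (q + 2) → Fin (q + 2) → K) (a' b' c' : Fin (q + 2)) :
    ∑ a, ∑ b, ∑ c, A a' a * B b' b * C c' c *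
        (if a = Fin.last (q + 1) ∧ b ≠ 0 ∧ b ≠ Fin.last (q + 1) ∧ c = Fin.rev b then (1 : K) else 0) =
      ∑ b, if b = 0 ∨ b = Fin.last (q + 1) then (0 : K)
        else A a' (Fin.last (q + 1)) * B b' b * C c' (Fin.rev b) := by
  rw [Finset.sum_eq_single (Fin.last (q + 1))]
  · refine Finset.sum_congr rfl fun b _ => ?_
    rw [Finset.sum_eq_single (Fin.rev b)]
    · by_cases hb : b = 0 ∨ b = Fin.last (q + 1)
      · rcases hb with hb | hb <;> simp [hb]
      · rw [if_neg hb]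
        obtain ⟨hb0, hbl⟩ := not_or.mp hb
        simp [hb0, hbl]
    · intro c _ hc
      simp [hc]
    · simp
  · intro a _ ha
    exact Finset.sum_eq_zero fun b _ => Finset.sum_eq_zero fun c _ => by simp [ha]
  · simp

/-- **The Gram identity.**  With `h + h = 1` and `i² = −1`, the matrix `U` (row `p` supported on
`{p, q+1−p}`: `U p p = 1`, `U p (q+1−p) = i` for `p < q+1−p`; `U p p = −i h`, `U p (q+1−p) = h` for
`p > q+1−p`; `U p p = 1` at a fixed point) satisfies `Σ_{1 ≤ a ≤ q} U (q+1−a) j · U a k = [j = k ∈ [1,q]]`: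
it carries the split form `Σ_a x_a x_{q+1−a}` to the diagonal form `Σ_j y_j²` of `CW_q`
(`2 × 2` blocks `(1, i; −i h, h)`: `1·h + i·(−i h)·… `, see the proof). [cite: ChristandlVranaZuiddam2021, Thm. 22] -/
theorem pairing_gram {i h : K} (hi : i * i = -1) (hh : h + h = 1)
    (U : Fin (q + 2) → Fin (q + 2) → K)
    (hU : U = fun p j : Fin (q + 2) =>
      if j = p then (if (p : ℕ) ≤ (Fin.rev p : ℕ) then 1 else -(i * h))
      else if j = Fin.rev p then (if (p : ℕ) < (Fin.rev p : ℕ) then i else h) else 0)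
    (j k : Fin (q + 2)) :
    ∑ a, (if a = 0 ∨ a = Fin.last (q + 1) then (0 : K) else U (Fin.rev a) j * U a k) =
      if j = k ∧ j ≠ 0 ∧ j ≠ Fin.last (q + 1) then 1 else 0 := by
  have hUpp : ∀ p : Fin (q + 2), U p p = if (p : ℕ) ≤ (Fin.rev p : ℕ) then 1 else -(i * h) := by
    intro p; rw [hU]; simp
  have hUpr : ∀ p : Fin (q + 2), p ≠ Fin.rev p →
      U p (Fin.rev p) = if (p : ℕ) < (Fin.rev p : ℕ) then i else h := by
    intro p hp; rw [hU]; simp [Ne.symm hp]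
  have hUrp : ∀ p : Fin (q + 2), p ≠ Fin.rev p →
      U (Fin.rev p) p = if (Fin.rev p : ℕ) < (p : ℕ) then i else h := by
    intro p hp
    have h1 := hUpr (Fin.rev p) (by rw [Fin.rev_rev]; exact Ne.symm hp)
    simpa only [Fin.rev_rev] using h1
  have hU0 : ∀ p j : Fin (q + 2), j ≠ p → j ≠ Fin.rev p → U p j = 0 := by
    intro p j h1 h2; rw [hU]; simp [h1, h2]
  have hval : ∀ x : Fin (q + 2), ((Fin.rev x : Fin (q + 2)) : ℕ) = q + 1 - (x : ℕ) := by
    intro x; rw [Fin.val_rev]; omega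
  by_cases hk : k = 0 ∨ k = Fin.last (q + 1)
  · have hz : ∀ a : Fin (q + 2),
        (if a = 0 ∨ a = Fin.last (q + 1) then (0 : K) else U (Fin.rev a) j * U a k) = 0 := by
      intro a
      split_ifs with ha
      · rfl
      · obtain ⟨ha0, hal⟩ := not_or.mp ha
        have hav := a.isLt
        rw [hU0 a k ?_ ?_, mul_zero]
        · rintro rfl; exact absurd hk ha
        · rintro rfl
          have h0 : (q + 1 - (a : ℕ) = 0) ∨ (q + 1 - (a : ℕ) = q + 1) := by
            rcases hk with h0 | h0
            · left; have := congrArg Fin.val h0; rwa [hval, Fin.val_zero] at this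
            · right; have := congrArg Fin.val h0; rwa [hval, Fin.val_last] at this
          have h1 : (a : ℕ) ≠ 0 := fun e => ha0 (Fin.ext (by rw [e, Fin.val_zero]))
          have h2 : (a : ℕ) ≠ q + 1 := fun e => hal (Fin.ext (by rw [e, Fin.val_last]))
          omega
    simp only [hz, Finset.sum_const_zero]
    symm
    apply if_neg
    rintro ⟨h1, h2, h3⟩
    rcases hk with rfl | rfl
    · exact h2 h1
    · exact h3 h1
  · obtain ⟨hk0, hkl⟩ := not_or.mp hk
    have hkv := k.isLt
    have hk0' : (k : ℕ) ≠ 0 := fun e => hk0 (Fin.ext (by rw [e, Fin.val_zero]))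
    have hkl' : (k : ℕ) ≠ q + 1 := fun e => hkl (Fin.ext (by rw [e, Fin.val_last]))
    have hrk0 : Fin.rev k ≠ 0 := by
      intro h0
      have := congrArg Fin.val h0
      rw [hval, Fin.val_zero] at this
      omega
    have hrkl : Fin.rev k ≠ Fin.last (q + 1) := by
      intro h0
      have := congrArg Fin.val h0
      rw [hval, Fin.val_last] at this
      omega
    by_cases hm : k = Fin.rev k
    · -- the middle index `k = q + 1 - k`
      rw [Fintype.sum_eq_single k ?_]
      · rw [if_neg hk, ← hm]
        by_cases hjk : j = k
        · rw [hjk, hUpp k, if_pos (le_of_eq (congrArg Fin.val hm)),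
            if_pos (show k = k ∧ k ≠ 0 ∧ k ≠ Fin.last (q + 1) from ⟨rfl, hk0, hkl⟩), mul_one]
        · rw [hU0 k j hjk (by rwa [← hm]), zero_mul,
            if_neg (show ¬(j = k ∧ j ≠ 0 ∧ j ≠ Fin.last (q + 1)) from fun h' => hjk h'.1)]
      · intro a hak
        split_ifs with ha
        · rfl
        · rw [hU0 a k (Ne.symm hak) ?_, mul_zero]
          intro hkra
          apply hak
          rw [← Fin.rev_rev a, ← hkra, ← hm]
    · rw [Fintype.sum_eq_add k (Fin.rev k) hm ?_]
      · rw [if_neg hk, if_neg (not_or.mpr ⟨hrk0, hrkl⟩), Fin.rev_rev]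
        have hne : (k : ℕ) ≠ (Fin.rev k : ℕ) := fun h' => hm (Fin.ext h')
        by_cases hjk : j = k
        · rw [hjk, hUrp k hm, hUpp k,
            if_pos (show k = k ∧ k ≠ 0 ∧ k ≠ Fin.last (q + 1) from ⟨rfl, hk0, hkl⟩)]
          rcases Nat.lt_or_gt_of_ne hne with hlt | hgt
          · rw [if_neg (show ¬((Fin.rev k : ℕ) < (k : ℕ)) by omega),
              if_pos (show (k : ℕ) ≤ (Fin.rev k : ℕ) by omega)]
            linear_combination hh
          · rw [if_pos (show (Fin.rev k : ℕ) < (k : ℕ) by omega),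
              if_neg (show ¬((k : ℕ) ≤ (Fin.rev k : ℕ)) by omega)]
            linear_combination (-2 * h) * hi + hh
        · by_cases hjr : j = Fin.rev k
          · rw [hjr, hUpp (Fin.rev k), Fin.rev_rev, hUpp k, hUpr k hm, hUrp k hm,
              if_neg (show ¬(Fin.rev k = k ∧ Fin.rev k ≠ 0 ∧ Fin.rev k ≠ Fin.last (q + 1)) from
                fun h' => hm h'.1.symm)]
            rcases Nat.lt_or_gt_of_ne hne with hlt | hgt
            · rw [if_neg (show ¬((Fin.rev k : ℕ) ≤ (k : ℕ)) by omega),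
                if_pos (show (k : ℕ) ≤ (Fin.rev k : ℕ) by omega), if_pos hlt,
                if_neg (show ¬((Fin.rev k : ℕ) < (k : ℕ)) by omega)]
              ring
            · rw [if_pos (show (Fin.rev k : ℕ) ≤ (k : ℕ) by omega),
                if_neg (show ¬((k : ℕ) ≤ (Fin.rev k : ℕ)) by omega),
                if_neg (show ¬((k : ℕ) < (Fin.rev k : ℕ)) by omega), if_pos hgt]
              ring
          · rw [hU0 (Fin.rev k) j hjr (by rw [Fin.rev_rev]; exact hjk), hU0 k j hjk hjr, zero_mul,
              zero_mul, add_zero,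
              if_neg (show ¬(j = k ∧ j ≠ 0 ∧ j ≠ Fin.last (q + 1)) from fun h' => hjk h'.1)]
      · rintro a ⟨hak, hark⟩
        split_ifs with ha
        · rfl
        · rw [hU0 a k (Ne.symm hak) ?_, mul_zero]
          intro hkra
          apply hark
          rw [hkra, Fin.rev_rev]

end Summit.MatrixMultiplication.MatrixMultiplication.Theorems.SaturationLadderSplitCwGram
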